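import Literature.Geometry.Lorentzian.GaussEquationFrame
import Literature.Geometry.Lorentzian.Stationary
import HarnessLib

/-!
# Crux `HawkingExtensionIsKerr` (stmt-FinalStateConjecture-17840), line `SketchIdeator2` —
# programme NH: preparation of the null Gauss equation (null-pair decomposition; the
# `K`-component of `D̄(df ∂ₐ)` along a chart line)

Helper file of the line lead (c5), programme "NH".  Two local ingredients of the Gauss equation of
a spacelike immersed surface `f : (N, f^*g) → (M, g)` of codimension two whose normal bundle is
framed by a NULL pair `K, N` (O'Neill 1983, Ch. 4, Lemma 1, Cor. 2, Lemma 3, Thm. 5 —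
"`D̄_V W = D_V W + II(V, W)`" — with the normal part written in a null frame instead of an
orthonormal one):

* `val_eq_inducedMetric_add_nullPair` — the tangent–normal decomposition of the metric at a point,
  `g(A, B) = (f^*g)(a, b) + (g(A, N) g(B, K) + g(A, K) g(B, N)) / g(K, N)` for `K, N` null,
  normal to `df(T_y N)`, `g(K, N) ≠ 0`, `dim M = dim N + 2` (the null-frame twin of
  `val_eq_inducedMetric_add_normal₂`, `HypersurfaceHessianCodimTwo.lean`);
* `val_covariantDerivAlong_mfderiv_localFrame_nullNormal₀` — along an affine chart path
  `ℓ t = ℓ 0 + t e_d`, `Q = φ⁻¹(ℓ 0)`, for an ambient field `K` differentiable at `f Q` and normal to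
  `df` NEAR `Q`: `g(D̄(df ∂ₐ ∘ φ⁻¹ ∘ ℓ)(0), K) = -g(∇_{df ∂_d} K, df ∂ₐ)(Q)` (differentiate
  `g(df ∂ₐ, K ∘ f) = 0` along the curve — a LOCAL version of
  `val_covariantDerivAlong_add_eq_zero_of_isNormalTo` —, then `D̄(K ∘ f ∘ c)(0) = ∇_{(f∘c)'(0)} K`,
  `covariantDerivAlong_comp_holds`, and `(f ∘ c)'(0) = df ∂_d`, `velocity_comp_symm_comp₀`).

Everything is proved; no definitions, no named facts.
-/

noncomputable section

set_option linter.dupNamespace false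

namespace Summit.FinalStateConjecture.FinalStateConjecture.Theorems.HawkingExtensionIsKerr.SketchIdeator2

open Set Filter Bundle Function Manifold Literature.Geometry.Lorentzian
open scoped Manifold ContDiff Topology

variable {E : Type*} [NormedAddCommGroup E] [NormedSpace ℝ E] {H : Type*} [TopologicalSpace H]
  {I : ModelWithCorners ℝ E H} {M : Type*} [TopologicalSpace M] [ChartedSpace H M]
  [IsManifold I ∞ M]

/-! ### Tangent–normal decomposition at a point, null pair -/

section Decomposition

variable [FiniteDimensional ℝ E] {n : ℕ∞ω}
  (g : PseudoRiemannianMetric I n E (TangentSpace I : M → Type _))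
  {E' : Type*} [NormedAddCommGroup E'] [NormedSpace ℝ E'] {H' : Type*} [TopologicalSpace H']
  {I' : ModelWithCorners ℝ E' H'} {N : Type*} [TopologicalSpace N] [ChartedSpace H' N]
  [IsManifold I' ∞ N] [FiniteDimensional ℝ E'] {f : N → M}
  (hpb : PseudoRiemannianMetric.contMDiff_pullbackBilin I M I' N n)
  (hfi : g.IsSpacelikeImmersion I' f)

/-- **Tangent–normal decomposition of the metric at a point of an immersed submanifold of
codimension two, null normal pair.**  Let `f : (N, f^*g) → (M, g)` be a spacelike immersion with
`dim M = dim N + 2` and `K, N₀ ∈ T_{f y} M` NULL vectors normal to `df(T_y N)` with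
`g(K, N₀) = ε ≠ 0`.  If the tangential components of `A, B ∈ T_{f y} M` are `a, b ∈ T_y N`, then
`g(A, B) = (f^*g)(a, b) + (g(A, N₀) g(B, K) + g(A, K) g(B, N₀)) / ε`: indeed
`A = df a + (g(A, N₀)/ε) K + (g(A, K)/ε) N₀`, the difference being orthogonal to
`df(T_y N) ⊕ ℝK ⊕ ℝN₀ = T_{f y} M` (dimension count).  O'Neill 1983, Ch. 4, pp. 97–100, with a
null frame of the normal plane. -/
theorem val_eq_inducedMetric_add_nullPair {y : N} {K N₀ A B : TangentSpace I (f y)}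
    {a b : TangentSpace I' y} {ε : ℝ}
    (hK0 : ∀ u : TangentSpace I' y, g.val (f y) K (mfderiv I' I f y u) = 0)
    (hN0 : ∀ u : TangentSpace I' y, g.val (f y) N₀ (mfderiv I' I f y u) = 0)
    (hKK : g.val (f y) K K = 0) (hNN : g.val (f y) N₀ N₀ = 0) (hKN : g.val (f y) K N₀ = ε)
    (hε : ε ≠ 0) (hdim : Module.finrank ℝ E = Module.finrank ℝ E' + 2)
    (hA : ∀ u : TangentSpace I' y, g.val (f y) A (mfderiv I' I f y u) =
      (g.inducedMetric f hpb hfi).val y a u)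
    (hB : ∀ u : TangentSpace I' y, g.val (f y) B (mfderiv I' I f y u) =
      (g.inducedMetric f hpb hfi).val y b u) :
    g.val (f y) A B = (g.inducedMetric f hpb hfi).val y a b +
      (g.val (f y) A N₀ * g.val (f y) B K + g.val (f y) A K * g.val (f y) B N₀) / ε := by
  have hinj := hfi.injective_mfderiv y
  have hNK : g.val (f y) N₀ K = ε := by rw [g.symm]; exact hKN
  -- `df(T_y N) ⊕ ℝ K ⊕ ℝ N₀ = T_{f y} M`
  haveI : FiniteDimensional ℝ (TangentSpace I (f y)) := inferInstanceAs (FiniteDimensional ℝ E)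
  set Φ : (E' × (ℝ × ℝ)) →ₗ[ℝ] TangentSpace I (f y) :=
    (mfderiv I' I f y).toLinearMap.comp (LinearMap.fst ℝ E' (ℝ × ℝ)) +
      ((LinearMap.fst ℝ ℝ ℝ).comp (LinearMap.snd ℝ E' (ℝ × ℝ))).smulRight K +
      ((LinearMap.snd ℝ ℝ ℝ).comp (LinearMap.snd ℝ E' (ℝ × ℝ))).smulRight N₀ with hΦ
  have hΦapply : ∀ (u : E') (r s : ℝ), Φ (u, (r, s)) = mfderiv I' I f y u + r • K + s • N₀ :=
    fun u r s ↦ rfl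
  have hΦinj : Function.Injective Φ := by
    refine (injective_iff_map_eq_zero _).2 fun q hq ↦ ?_
    obtain ⟨u, r, s⟩ := q
    rw [hΦapply] at hq
    have h1 : s * ε = 0 := by
      have := congrArg (fun w ↦ g.val (f y) K w) hq
      simpa [map_add, map_smul, hK0 u, hKK, hKN] using this
    have h2 : r * ε = 0 := by
      have := congrArg (fun w ↦ g.val (f y) N₀ w) hq
      simpa [map_add, map_smul, hN0 u, hNN, hNK] using this
    have hs : s = 0 := (mul_eq_zero.1 h1).resolve_right hε
    have hr : r = 0 := (mul_eq_zero.1 h2).resolve_right hε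
    rw [hr, hs, zero_smul, zero_smul, add_zero, add_zero] at hq
    have hu : u = 0 := (injective_iff_map_eq_zero _).1 hinj u hq
    simp [hu, hr, hs]
  have hrank : Module.finrank ℝ (E' × (ℝ × ℝ)) = Module.finrank ℝ (TangentSpace I (f y)) := by
    show Module.finrank ℝ (E' × (ℝ × ℝ)) = Module.finrank ℝ E
    rw [Module.finrank_prod, Module.finrank_prod, Module.finrank_self, hdim]
  have hΦsurj : Function.Surjective Φ :=
    (LinearMap.injective_iff_surjective_of_finrank_eq_finrank hrank).1 hΦinj
  -- the decomposition of `A`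
  have hdec : A = mfderiv I' I f y a + (g.val (f y) A N₀ / ε) • K + (g.val (f y) A K / ε) • N₀ := by
    have horth : ∀ w : TangentSpace I (f y),
        g.val (f y) (A - mfderiv I' I f y a - (g.val (f y) A N₀ / ε) • K -
          (g.val (f y) A K / ε) • N₀) w = 0 := by
      intro w
      obtain ⟨⟨u, r, s⟩, rfl⟩ := hΦsurj w
      rw [hΦapply, map_add, map_add, map_smul, map_smul]
      have h1 : g.val (f y) (A - mfderiv I' I f y a - (g.val (f y) A N₀ / ε) • K -
          (g.val (f y) A K / ε) • N₀) (mfderiv I' I f y u) = 0 := by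
        simp only [map_sub, map_smul, _root_.sub_apply, _root_.smul_apply, hA u, hK0 u, hN0 u,
          smul_eq_mul, mul_zero, sub_zero]
        exact sub_self _
      have h2 : g.val (f y) (A - mfderiv I' I f y a - (g.val (f y) A N₀ / ε) • K -
          (g.val (f y) A K / ε) • N₀) K = 0 := by
        simp only [map_sub, map_smul, _root_.sub_apply, _root_.smul_apply, hKK, hNK, smul_eq_mul]
        rw [g.symm (f y) (mfderiv I' I f y a) K, hK0 a]
        field_simp
        ring
      have h3 : g.val (f y) (A - mfderiv I' I f y a - (g.val (f y) A N₀ / ε) • K -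
          (g.val (f y) A K / ε) • N₀) N₀ = 0 := by
        simp only [map_sub, map_smul, _root_.sub_apply, _root_.smul_apply, hNN, hKN, smul_eq_mul]
        rw [g.symm (f y) (mfderiv I' I f y a) N₀, hN0 a]
        field_simp
        ring
      rw [h1, h2, h3, smul_zero, smul_zero, add_zero, add_zero]
    have h0 := g.nondegenerate (f y) _ horth
    rw [sub_sub, sub_sub, sub_eq_zero] at h0
    rw [← add_assoc] at h0
    exact h0
  -- pair with `B`
  conv_lhs => rw [hdec]
  rw [map_add, map_add, map_smul, map_smul, _root_.add_apply, _root_.add_apply, _root_.smul_apply,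
    _root_.smul_apply, g.symm (f y) (mfderiv I' I f y a) B, hB a,
    (g.inducedMetric f hpb hfi).symm y b a, g.symm (f y) K B, g.symm (f y) N₀ B, smul_eq_mul,
    smul_eq_mul]
  ring

end Decomposition

/-! ### The `K`-component of `D̄(df ∂ₐ)` along an affine chart path -/

section NullNormal

variable [FiniteDimensional ℝ E] [CompleteSpace E]
  (g : PseudoRiemannianMetric I ∞ E (TangentSpace I : M → Type _)) [g.HasLeviCivita]
  {E' : Type*} [NormedAddCommGroup E'] [NormedSpace ℝ E'] {H' : Type*} [TopologicalSpace H']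
  {I' : ModelWithCorners ℝ E' H'} {N : Type*} [TopologicalSpace N] [ChartedSpace H' N]
  [IsManifold I' ∞ N] [FiniteDimensional ℝ E'] [I'.Boundaryless] {f : N → M}
  {ι : Type*} [Fintype ι] [DecidableEq ι] (b' : Module.Basis ι ℝ E') {y₀ : N}

omit [DecidableEq ι] [IsManifold I' ∞ N] [FiniteDimensional ℝ E'] [I'.Boundaryless] in
/-- **Differentiating a LOCAL normality relation along a curve.**  If `g(ν ∘ c, df(W ∘ c)) = 0`
for `t` near `0` and both lifts are differentiable at `0`, then
`g(D̄(ν∘c)(0), df W(c 0)) + g(ν(c 0), D̄(df W ∘ c)(0)) = 0` (metric compatibility along `f ∘ c`).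
Local form of `val_covariantDerivAlong_add_eq_zero_of_isNormalTo`; O'Neill 1983, Ch. 4,
Cor. 4.2 (5). -/
theorem val_covariantDerivAlong_add_eq_zero_of_eventually {ν : NormalField I f} (c : ℝ → N)
    (W : Π z : N, TangentSpace I' z)
    (hν : ∀ᶠ t in 𝓝 (0 : ℝ), g.val (f (c t)) (ν (c t)) (mfderiv I' I f (c t) (W (c t))) = 0)
    (hV : MDifferentiableAt 𝓘(ℝ, ℝ) I.tangent
      (fun t ↦ (TotalSpace.mk' E ((f ∘ c) t) (ν (c t)) : TangentBundle I M)) 0)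
    (hW : MDifferentiableAt 𝓘(ℝ, ℝ) I.tangent
      (fun t ↦ (TotalSpace.mk' E ((f ∘ c) t) (mfderiv I' I f (c t) (W (c t))) :
        TangentBundle I M)) 0) :
    g.val (f (c 0)) (covariantDerivAlong g.leviCivita (f ∘ c) (fun t ↦ ν (c t)) 0)
        (mfderiv I' I f (c 0) (W (c 0))) +
      g.val (f (c 0)) (ν (c 0))
        (covariantDerivAlong g.leviCivita (f ∘ c) (fun t ↦ mfderiv I' I f (c t) (W (c t))) 0) =
      0 := by
  have h := g.hasDerivAt_val_apply_along
    (PseudoRiemannianMetric.isLeviCivita_leviCivita_holds (g := g)).2 (γ := f ∘ c)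
    (V := fun t ↦ ν (c t)) (W := fun t ↦ mfderiv I' I f (c t) (W (c t))) (t₀ := 0) hV hW
  have hev : (fun t ↦ g.val ((f ∘ c) t) (ν (c t)) (mfderiv I' I f (c t) (W (c t)))) =ᶠ[𝓝 0]
      fun _ ↦ (0 : ℝ) :=
    hν.mono fun t ht ↦ ht
  have h0 : HasDerivAt (fun t ↦ g.val ((f ∘ c) t) (ν (c t)) (mfderiv I' I f (c t) (W (c t))))
      0 0 :=
    (hasDerivAt_const (0 : ℝ) (0 : ℝ)).congr_of_eventuallyEq hev
  exact h.unique h0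

omit [FiniteDimensional ℝ E'] in
/-- **The `K`-component of `D̄(df ∂ₐ)` along an affine chart path: `-g(∇_{df ∂_d} K, df ∂ₐ)`.**
For an ambient vector field `K`, differentiable at `f Q`, `Q = φ⁻¹(ℓ 0)`, and normal to `df` at the
points of `N` near `Q`, and the affine path `ℓ t = ℓ 0 + t e_d`:
`g(D̄(df ∂ₐ ∘ φ⁻¹ ∘ ℓ)(0), K(f Q)) = -g(∇_{df_Q ∂_d} K, df_Q ∂ₐ)` — differentiate
`g(df ∂ₐ, K ∘ f) = 0` along the curve (`val_covariantDerivAlong_add_eq_zero_of_eventually`),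
identify `D̄(K ∘ f ∘ c)(0)` with `∇_{(f ∘ c)'(0)} K` (`covariantDerivAlong_comp_holds`) and
`(f ∘ c)'(0)` with `df ∂_d` (`velocity_comp_symm_comp₀`).  O'Neill 1983, Ch. 4, Lemma 4 and
Cor. 4.2 (5); Ch. 3, Prop. 3.18 (3). -/
theorem val_covariantDerivAlong_mfderiv_localFrame_nullNormal₀ (hf2 : ContMDiff I' I 2 f)
    {K : Π x : M, TangentSpace I x} {ℓ : ℝ → E'} (hℓ0 : ℓ 0 ∈ (extChartAt I' y₀).target) {d : ι}
    (hℓaff : ∀ t, ℓ t = ℓ 0 + t • b' d) (a : ι)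
    (hK : MDiffAt (T% K) (f ((extChartAt I' y₀).symm (ℓ 0))))
    (hn : ∀ᶠ y in 𝓝 ((extChartAt I' y₀).symm (ℓ 0)), ∀ u : TangentSpace I' y,
      g.val (f y) (K (f y)) (mfderiv I' I f y u) = 0) :
    g.val (f ((extChartAt I' y₀).symm (ℓ 0)))
        (covariantDerivAlong g.leviCivita (fun t : ℝ ↦ f ((extChartAt I' y₀).symm (ℓ t))) (fun t ↦
            mfderiv I' I f ((extChartAt I' y₀).symm (ℓ t)) ((trivializationAt E' (TangentSpace I')
            y₀).localFrame b' a ((extChartAt I' y₀).symm (ℓ t)))) 0)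
        (K (f ((extChartAt I' y₀).symm (ℓ 0)))) =
      - g.val (f ((extChartAt I' y₀).symm (ℓ 0)))
          (g.leviCivita K (f ((extChartAt I' y₀).symm (ℓ 0)))
            (mfderiv I' I f ((extChartAt I' y₀).symm (ℓ 0)) ((trivializationAt E'
              (TangentSpace I') y₀).localFrame b' d ((extChartAt I' y₀).symm (ℓ 0)))))
          (mfderiv I' I f ((extChartAt I' y₀).symm (ℓ 0)) ((trivializationAt E'
            (TangentSpace I') y₀).localFrame b' a ((extChartAt I' y₀).symm (ℓ 0)))) := by
  have hsrc : (extChartAt I' y₀).symm (ℓ 0) ∈ (chartAt H' y₀).source := by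
    rw [← extChartAt_source I']; exact (extChartAt I' y₀).map_target hℓ0
  have hℓfun : ℓ = fun t : ℝ ↦ ℓ 0 + t • b' d := funext hℓaff
  have hℓ : HasDerivAt ℓ (b' d) 0 := by
    rw [hℓfun]
    simpa using ((hasDerivAt_id (0 : ℝ)).smul_const (b' d)).const_add (ℓ 0)
  have h1s : ContMDiffAt 𝓘(ℝ, E') I' ∞ (extChartAt I' y₀).symm (ℓ 0) :=
    (contMDiffOn_extChartAt_symm y₀).contMDiffAt ((isOpen_extChartAt_target y₀).mem_nhds hℓ0)
  have hγ : MDifferentiableAt 𝓘(ℝ, ℝ) I' (fun t : ℝ ↦ (extChartAt I' y₀).symm (ℓ t)) 0 :=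
    (h1s.mdifferentiableAt (by simp)).comp 0 hℓ.differentiableAt.mdifferentiableAt
  have hfd : ∀ z, MDifferentiableAt I' I f z := hf2.mdifferentiable two_ne_zero
  have hfγ : MDifferentiableAt 𝓘(ℝ, ℝ) I (fun t : ℝ ↦ f ((extChartAt I' y₀).symm (ℓ t))) 0 :=
    (hfd _).comp 0 hγ
  -- the lift of `K ∘ f` is differentiable at `Q`
  have hνd : MDifferentiableAt I' I.tangent
      (fun x ↦ (TotalSpace.mk' E (f x) (K (f x)) : TangentBundle I M)) ((extChartAt I' y₀).symm
        (ℓ 0)) :=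
    hK.comp _ (hfd _)
  have hI'1 : IsManifold I' (1 + 1) N := inferInstanceAs (IsManifold I' 2 N)
  have hVB1 : ContMDiffVectorBundle 1 E' (TangentSpace I' : N → Type _) I' :=
    TangentBundle.contMDiffVectorBundle
  have hSa : MDiffAt (T% ((trivializationAt E' (TangentSpace I') y₀).localFrame b' a)) ((extChartAt
      I' y₀).symm (ℓ 0)) :=
    (contMDiffAt_localFrame_of_mem 1 _ b' a (by simpa using hsrc)).mdifferentiableAt one_ne_zero
  -- normality along the curve near `0`
  have hnc : ∀ᶠ t in 𝓝 (0 : ℝ), g.val (f ((extChartAt I' y₀).symm (ℓ t)))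
      (K (f ((extChartAt I' y₀).symm (ℓ t))))
      (mfderiv I' I f ((extChartAt I' y₀).symm (ℓ t)) ((trivializationAt E' (TangentSpace I')
        y₀).localFrame b' a ((extChartAt I' y₀).symm (ℓ t)))) = 0 := by
    have h := hγ.continuousAt.eventually hn
    exact h.mono fun t ht ↦ ht _
  have h := val_covariantDerivAlong_add_eq_zero_of_eventually g (ν := fun y ↦ K (f y))
    (fun t : ℝ ↦ (extChartAt I' y₀).symm (ℓ t))
    ((trivializationAt E' (TangentSpace I') y₀).localFrame b' a) hnc
    (mdifferentiableAt_lift_comp_curve (I := I) hγ hνd)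
    (mdifferentiableAt_lift_comp_curve (I := I) hγ (mdifferentiableAt_lift_mfderiv hf2 hSa))
  -- `D̄(K ∘ f ∘ c)(0) = ∇_{(f∘c)'(0)} K = ∇_{df ∂_d} K`
  have hcomp := covariantDerivAlong_comp_holds (cov := g.leviCivita)
    (γ := fun t : ℝ ↦ f ((extChartAt I' y₀).symm (ℓ t))) (Y := K) (t₀ := 0) hfγ hK
  rw [velocity_comp_symm_comp₀ b' hℓ0 hℓ (hfd _), sum_coord_basis_smul] at hcomp
  have h' : g.val (f ((extChartAt I' y₀).symm (ℓ 0)))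
      (covariantDerivAlong g.leviCivita (fun t : ℝ ↦ f ((extChartAt I' y₀).symm (ℓ t)))
        (fun t ↦ K (f ((extChartAt I' y₀).symm (ℓ t)))) 0)
      (mfderiv I' I f ((extChartAt I' y₀).symm (ℓ 0)) ((trivializationAt E' (TangentSpace I')
          y₀).localFrame b' a ((extChartAt I' y₀).symm (ℓ 0)))) +
      g.val (f ((extChartAt I' y₀).symm (ℓ 0))) (K (f ((extChartAt I' y₀).symm (ℓ 0))))
        (covariantDerivAlong g.leviCivita (fun t : ℝ ↦ f ((extChartAt I' y₀).symm (ℓ t))) (fun t ↦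
            mfderiv I' I f ((extChartAt I' y₀).symm (ℓ t)) ((trivializationAt E' (TangentSpace I')
            y₀).localFrame b' a ((extChartAt I' y₀).symm (ℓ t)))) 0) = 0 := h
  have hc' : covariantDerivAlong g.leviCivita (fun t : ℝ ↦ f ((extChartAt I' y₀).symm (ℓ t)))
        (fun t ↦ K (f ((extChartAt I' y₀).symm (ℓ t)))) 0 =
      g.leviCivita K (f ((extChartAt I' y₀).symm (ℓ 0)))
        (mfderiv I' I f ((extChartAt I' y₀).symm (ℓ 0)) ((trivializationAt E' (TangentSpace I')
          y₀).localFrame b' d ((extChartAt I' y₀).symm (ℓ 0)))) := hcomp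
  rw [hc'] at h'
  rw [g.symm]
  linarith

end NullNormal

/-- **Registered sub-goal form of the local normality differentiation** (closed statement over
`E4`-charted manifolds and surfaces modelled on `ℝ²`, crux stmt-FinalStateConjecture-17840). -/
theorem stub_nh_gaussNullPrep : ∀ (M : Type) [TopologicalSpace M] [ChartedSpace E4 M] [IsManifold (𝓡 4) ∞ M] (g : PseudoRiemannianMetric (𝓡 4) ∞ E4 (TangentSpace (𝓡 4) : M → Type _)) [g.HasLeviCivita] (S : Type) [TopologicalSpace S] [ChartedSpace (EuclideanSpace ℝ (Fin 2)) S] (f : S → M) (ν : Π y : S, TangentSpace (𝓡 4) (f y)) (c : ℝ → S) (W : Π z : S, TangentSpace (𝓡 2) z), (∀ᶠ t in 𝓝 (0 : ℝ), g.val (f (c t)) (ν (c t)) (mfderiv (𝓡 2) (𝓡 4) f (c t) (W (c t))) = 0) → MDifferentiableAt 𝓘(ℝ, ℝ) (𝓡 4).tangent (fun t ↦ (Bundle.TotalSpace.mk' E4 ((f ∘ c) t) (ν (c t)) : TangentBundle (𝓡 4) M)) 0 → MDifferentiableAt 𝓘(ℝ, ℝ) (𝓡 4).tangent (fun t ↦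 (Bundle.TotalSpace.mk' E4 ((f ∘ c) t) (mfderiv (𝓡 2) (𝓡 4) f (c t) (W (c t))) : TangentBundle (𝓡 4) M)) 0 → g.val (f (c 0)) (covariantDerivAlong g.leviCivita (f ∘ c) (fun t ↦ ν (c t)) 0) (mfderiv (𝓡 2) (𝓡 4) f (c 0) (W (c 0))) + g.val (f (c 0)) (ν (c 0)) (covariantDerivAlong g.leviCivita (f ∘ c) (fun t ↦ mfderiv (𝓡 2) (𝓡 4) f (c t) (W (c t))) 0) = 0 :=
  fun _ _ _ _ g _ _ _ _ _ _ c W hν hV hW ↦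
    val_covariantDerivAlong_add_eq_zero_of_eventually g c W hν hV hW


end Summit.FinalStateConjecture.FinalStateConjecture.Theorems.HawkingExtensionIsKerr.SketchIdeator2

end
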